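import Summits.Ventures.HodgeRepro2.T5SU11ResolventOfDecaySolution
import Summits.Ventures.HodgeRepro2.T5SU11KernelResolventIdentity

/-!
# The difference of two kernels extends continuously to the corner:
`K_λ(t, s) − K_{λ₂}(t, s) → (μ − μ₂) ∫_0^∞ χ_λ χ_{λ₂} sinh 2r dr` as `(t, s) → (0, 0)`

The kernel resolvent identity `K_λ(t, s) − K_{λ₂}(t, s) = (μ − μ₂) ∫ K_λ(t, r) K_{λ₂}(r, s) sinh 2r dr` (row 5xx) is read at the corner
under the dominations `|K_λ(t, r)| ≤ Φ_λ χ_λ(r)`, `|K_{λ₂}(r, s)| ≤ Φ_{λ₂} χ_{λ₂}(r)` for `t, s ≤ 1` (row 643) with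
`χ_λ χ_{λ₂} sinh 2r ∈ L¹` (row 643): the limits `K_λ(t, r) → −χ_λ(r)`, `K_{λ₂}(r, s) → −χ_{λ₂}(r)` (row 624) give

* `tendsto_integral_kernel_mul_kernel_corner` — `∫ K_λ(t, r) K_{λ₂}(r, s) sinh 2r dr → ∫ χ_λ χ_{λ₂} sinh 2r dr`;
* `tendsto_kernel_sub_corner` — **`K_λ(t, s) − K_{λ₂}(t, s) → (μ − μ₂) ∫_0^∞ χ_λ(r) χ_{λ₂}(r) sinh 2r dr` as `(t, s) → (0⁺, 0⁺)`**, for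
  ALL `λ, λ₂ > 1` (no disc condition): the corner singularities of two kernels cancel to a finite value — the kernel counterpart of
  row 644 (`χ_λ − χ_{λ₂} → −(μ − μ₂) ∫ χ_{λ₂} χ_λ sinh 2s ds`), consistent with `K_λ(0⁺, s) = −χ_λ(s)`.

Nothing is claimed about (N).

Blind lane: Mathlib + the HodgeRepro2 prefix only; no sorry; axioms ⊆ {propext, Classical.choice,
Quot.sound}.
-/

namespace Summit.Ventures.HodgeRepro2.T5SU11KernelDifferenceCorner

open Filter Topology MeasureTheory
open Set (Ioi Ioc Icc)
open T5SU11Cartan T5SU11SphericalFunction T5SU11SphericalBounds T5SU11SphericalDecay T5SU11ReductionOfOrder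
  T5SU11RadialGreenKernel T5SU11RadialGreenImproper T5SU11RadialGreenImproperOrigin T5SU11RadialGreenImproperDecaySource
  T5SU11ResolventKernelComposition
  T5SU11ResolventTransformClass T5SU11KernelEnds T5SU11KernelResolventIdentity T5SU11KernelDifferenceRegularity
  T5SU11SphericalDecayFluxIdentity T5SU11ResolventOfDecaySolution

section measure

variable [MeasurableSpace Circle] [BorelSpace Circle]

variable {lam lam₂ : ℝ} (hlam : 1 < lam) (hlam₂ : 1 < lam₂)

include hlam hlam₂ in
/-- `K_λ(t, r) K_{λ₂}(r, s) sinh 2r` is integrable on `(0, ∞)` for `t, s > 0`. -/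
theorem integrableOn_kernel_mul_kernel_mul_sinh' {t s : ℝ} (ht : 0 < t) (hs : 0 < s) :
    IntegrableOn (fun r => sphGreenKernel lam t r * sphGreenKernel lam₂ r s * Real.sinh (2 * r)) (Ioi 0) := by
  obtain ⟨M, hM0, hM⟩ := kernel_source_bounded hlam₂ hs
  obtain ⟨C, s₀, hC⟩ := kernel_source_decay hlam₂ hs
  have hg := kernel_source_continuousOn hlam₂ hs
  have hε : 2 - lam < lam₂ := by linarith
  have hB := integrableOn_sph_mul_mul_sinh_Ioc hg hM hM0 lam
  have hA := integrableOn_sphDecay_mul_mul_sinh hlam hg hM hM0 hε hC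
  exact integrableOn_kernel_mul hB hA ht

include hlam hlam₂ in
/-- **`∫ K_λ(t, r) K_{λ₂}(r, s) sinh 2r dr → ∫ χ_λ χ_{λ₂} sinh 2r dr` as `(t, s) → (0⁺, 0⁺)`** (dominated convergence). -/
theorem tendsto_integral_kernel_mul_kernel_corner :
    Tendsto (fun p : ℝ × ℝ => ∫ r in Ioi 0, sphGreenKernel lam p.1 r * sphGreenKernel lam₂ r p.2 * Real.sinh (2 * r))
      (𝓝[>] 0 ×ˢ 𝓝[>] 0) (𝓝 (∫ r in Ioi 0, sphDecay lam r * sphDecay lam₂ r * Real.sinh (2 * r))) := by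
  obtain ⟨Φ, hΦ0, hΦ⟩ := exists_sph_hyp_le lam
  obtain ⟨Φ₂, hΦ₂0, hΦ₂⟩ := exists_sph_hyp_le lam₂
  have hχχ : IntegrableOn (fun r => sphDecay lam r * sphDecay lam₂ r * Real.sinh (2 * r)) (Ioi 0) := by
    have h := integrableOn_sphDecay_mul_sphDecay_mul_sinh hlam₂ hlam
    refine IntegrableOn.congr_fun h ?_ measurableSet_Ioi
    intro r _
    simp only
  have hbound : Integrable (fun r => Φ * Φ₂ * (sphDecay lam r * sphDecay lam₂ r * Real.sinh (2 * r)))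
      (volume.restrict (Ioi 0)) := hχχ.const_mul _
  have hsq : ∀ᶠ p : ℝ × ℝ in 𝓝[>] 0 ×ˢ 𝓝[>] 0, 0 < p.1 ∧ p.1 ≤ 1 ∧ 0 < p.2 ∧ p.2 ≤ 1 := by
    filter_upwards [Filter.prod_mem_prod (Ioc_mem_nhdsGT one_pos) (Ioc_mem_nhdsGT one_pos)] with p hp
    exact ⟨hp.1.1, hp.1.2, hp.2.1, hp.2.2⟩
  have hmeas : ∀ᶠ p : ℝ × ℝ in 𝓝[>] 0 ×ˢ 𝓝[>] 0, AEStronglyMeasurable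
      (fun r => sphGreenKernel lam p.1 r * sphGreenKernel lam₂ r p.2 * Real.sinh (2 * r)) (volume.restrict (Ioi 0)) := by
    filter_upwards [hsq] with p hp
    exact (integrableOn_kernel_mul_kernel_mul_sinh' hlam hlam₂ hp.1 hp.2.2.1).aestronglyMeasurable
  have hdom : ∀ᶠ p : ℝ × ℝ in 𝓝[>] 0 ×ˢ 𝓝[>] 0, ∀ᵐ r ∂(volume.restrict (Ioi 0)),
      ‖sphGreenKernel lam p.1 r * sphGreenKernel lam₂ r p.2 * Real.sinh (2 * r)‖
        ≤ Φ * Φ₂ * (sphDecay lam r * sphDecay lam₂ r * Real.sinh (2 * r)) := by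
    filter_upwards [hsq] with p hp
    refine ae_restrict_of_forall_mem measurableSet_Ioi fun r hr => ?_
    have hr' : (0 : ℝ) < r := hr
    have h1 := abs_kernel_le_mul_sphDecay_of_le_one hlam hΦ hp.1 hp.2.1 hr'
    have h2 : |sphGreenKernel lam₂ r p.2| ≤ Φ₂ * sphDecay lam₂ r := by
      rw [sphGreenKernel_symm]
      exact abs_kernel_le_mul_sphDecay_of_le_one hlam₂ hΦ₂ hp.2.2.1 hp.2.2.2 hr'
    have hsh : 0 ≤ Real.sinh (2 * r) := (sinh_two_mul_pos hr').le
    have hΦχ : 0 ≤ Φ * sphDecay lam r := mul_nonneg hΦ0.le (sphDecay_pos hlam hr').le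
    rw [Real.norm_eq_abs, abs_mul, abs_mul, abs_of_nonneg hsh]
    calc |sphGreenKernel lam p.1 r| * |sphGreenKernel lam₂ r p.2| * Real.sinh (2 * r)
        ≤ (Φ * sphDecay lam r) * (Φ₂ * sphDecay lam₂ r) * Real.sinh (2 * r) :=
          mul_le_mul_of_nonneg_right (mul_le_mul h1 h2 (abs_nonneg _) hΦχ) hsh
      _ = Φ * Φ₂ * (sphDecay lam r * sphDecay lam₂ r * Real.sinh (2 * r)) := by ring
  have hlim : ∀ᵐ r ∂(volume.restrict (Ioi 0)), Tendsto
      (fun p : ℝ × ℝ => sphGreenKernel lam p.1 r * sphGreenKernel lam₂ r p.2 * Real.sinh (2 * r))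
      (𝓝[>] 0 ×ˢ 𝓝[>] 0) (𝓝 (sphDecay lam r * sphDecay lam₂ r * Real.sinh (2 * r))) := by
    refine ae_restrict_of_forall_mem measurableSet_Ioi fun r hr => ?_
    have hr' : (0 : ℝ) < r := hr
    have h1 : Tendsto (fun p : ℝ × ℝ => sphGreenKernel lam p.1 r) (𝓝[>] 0 ×ˢ 𝓝[>] 0) (𝓝 (-sphDecay lam r)) :=
      (tendsto_kernel_nhdsGT_zero lam hr').comp tendsto_fst
    have h2 : Tendsto (fun p : ℝ × ℝ => sphGreenKernel lam₂ r p.2) (𝓝[>] 0 ×ˢ 𝓝[>] 0) (𝓝 (-sphDecay lam₂ r)) := by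
      have := (tendsto_kernel_nhdsGT_zero lam₂ hr').comp (tendsto_snd (f := 𝓝[>] (0 : ℝ)) (g := 𝓝[>] (0 : ℝ)))
      refine this.congr fun p => ?_
      simp only [Function.comp]
      exact sphGreenKernel_symm lam₂ p.2 r
    have := (h1.mul h2).mul_const (Real.sinh (2 * r))
    simpa only [neg_mul_neg] using this
  exact tendsto_integral_filter_of_dominated_convergence _ hmeas hdom hbound hlim

include hlam hlam₂ in
/-- **THE DIFFERENCE OF TWO KERNELS EXTENDS CONTINUOUSLY TO THE CORNER**:
`K_λ(t, s) − K_{λ₂}(t, s) → (μ − μ₂) ∫_0^∞ χ_λ χ_{λ₂} sinh 2r dr` as `(t, s) → (0⁺, 0⁺)`. -/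
theorem tendsto_kernel_sub_corner :
    Tendsto (fun p : ℝ × ℝ => sphGreenKernel lam p.1 p.2 - sphGreenKernel lam₂ p.1 p.2) (𝓝[>] 0 ×ˢ 𝓝[>] 0)
      (𝓝 ((lam * (lam - 2) - lam₂ * (lam₂ - 2)) * ∫ r in Ioi 0, sphDecay lam r * sphDecay lam₂ r * Real.sinh (2 * r))) := by
  have h := (tendsto_integral_kernel_mul_kernel_corner hlam hlam₂).const_mul (lam * (lam - 2) - lam₂ * (lam₂ - 2))
  refine h.congr' ?_
  filter_upwards [Filter.prod_mem_prod (self_mem_nhdsWithin) (self_mem_nhdsWithin)] with p hp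
  exact kernel_resolvent_identity hlam hlam₂ hp.1 hp.2

end measure

end Summit.Ventures.HodgeRepro2.T5SU11KernelDifferenceCorner
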